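import Literature.NumberTheory.Transcendental.CurvePeriodsContinuousHomotopyProofs
import HarnessLib

/-!
# Periods of curve type: continuous triangles and continuous reparametrisations

Companion of `Literature/NumberTheory/Transcendental/CurvePeriods.lean` (Huber–Wüstholz 2022,
Thm. 13.3 (2), rendered on explicit period symbols `(Z, ω, γ)` with the elementary relations
(R1)–(R5); the general statement is the named fact `HuberWustholzCurvePeriods`). Relation (R5) is
the boundary of a `C¹` triangle with algebraic vertices; relative SINGULAR homology uses
continuous simplices. From the continuous-homotopy theorem of
`CurvePeriodsContinuousHomotopyProofs.lean` this file derives, for every embedded smooth affine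
curve `Z` over `ℚ̄`:

* `span_boundary_of_continuousTriangle` — **(R5) for CONTINUOUS triangles**: if
  `τ : Δ → Z(ℂ)` is merely continuous and its three edges `e₀₁, e₁₂, e₀₂` are `C¹` paths with
  algebraic end points, then `(Z, ω, e₀₁) + (Z, ω, e₁₂) − (Z, ω, e₀₂) ∼ 0` (the triangle is a
  continuous homotopy with fixed end points from `e₀₂` to the `C¹` concatenation `e₀₁ ⋆ e₁₂`,
  `CurvePath.concat`; then `span_concat`);
* `span_single_sub_single_of_continuousReparam` — **continuous reparametrisation invariance**:
  `(Z, ω, γ ∘ φ) ∼ (Z, ω, γ)` for `φ : [0,1] → [0,1]` continuous with `φ(0) = 0`, `φ(1) = 1`,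
  whenever `γ ∘ φ` is again a `C¹` path;
* `span_square_of_continuous` — **continuous squares**: if `H : [0,1]² → Z(ℂ)` is continuous
  and its four sides agree with `C¹` paths `b` (bottom), `r` (right), `τ` (top), `l` (left) with
  algebraic end points, then `(Z, ω, l) + (Z, ω, τ) − (Z, ω, b) − (Z, ω, r) ∼ 0` (`l ⋆ τ` and
  `b ⋆ r` are homotopic with fixed end points through `H` composed with a convex combination of
  the two broken edge paths of the square);
* `span_single_sub_single_of_continuousFreeHomotopy` — **free homotopies of loops** through a
  continuous `H` whose base-point track `s ↦ H(s, 0) = H(s, 1)` is a `C¹` path: the two loops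
  `H(0, ·)`, `H(1, ·)` have the same symbol.

## References

* A. Huber, G. Wüstholz, *Transcendence and Linear Relations of 1-Periods*, Cambridge Tracts in
  Mathematics 227, CUP 2022 [HuberWustholz2022]: §3.3.1 (pp. 42–44 of the held text), Thm. 13.3 (2)
  (p. 121).
-/

noncomputable section

open scoped BigOperators Topology
open MvPolynomial Set Filter

namespace Literature.NumberTheory.Transcendental

namespace CurvePeriods

set_option quotPrecheck false in
/-- Membership in the `ℚ̄`-span of the elementary relations, in the format of the conclusion of
`HuberWustholzCurvePeriods`. -/
local notation "InSpan" c:max => ∃ (k : ℕ) (ρ : Fin k → (PeriodSymbol →₀ ℂ)) (a : Fin k → ℂ),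
  (∀ l, IsElementaryRelation (ρ l)) ∧ (∀ l, IsAlgebraic ℚ (a l)) ∧ c = ∑ l, a l • ρ l

variable {Z : CurveData}

/-! ### Continuous reparametrisation -/

/-- **Continuous reparametrisation invariance**: for `φ : [0,1] → [0,1]` continuous with
`φ(0) = 0`, `φ(1) = 1` and `C¹` paths `γ`, `γ′` with `γ′ = γ ∘ φ` on `[0,1]`,
`(Z, ω, γ′) − (Z, ω, γ)` lies in the span of the elementary relations (the continuous homotopy
`γ((1 − s)φ(t) + st)`). [cite: HuberWustholz2022, §3.3.1 (pp. 42–44)] -/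
theorem span_single_sub_single_of_continuousReparam (hZ : Z.IsSmoothAffineCurve)
    (ω : Fin Z.n → MvPolynomial (Fin Z.n) ℂ) (h : ∀ i, HasAlgCoeffs (ω i)) (γ γ' : CurvePath Z)
    (φ : ℝ → ℝ) (hφ : ContinuousOn φ (Icc 0 1)) (hφI : MapsTo φ (Icc 0 1) (Icc 0 1))
    (hφ0 : φ 0 = 0) (hφ1 : φ 1 = 1) (hγ' : ∀ t ∈ Icc (0 : ℝ) 1, γ'.toFun t = γ.toFun (φ t)) :
    InSpan (Finsupp.single (⟨Z, hZ, ω, h, γ'⟩ : PeriodSymbol) (1 : ℂ) -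
        Finsupp.single ⟨Z, hZ, ω, h, γ⟩ 1) := by
  have hL : ContinuousOn (fun q : ℝ × ℝ => (1 - q.1) * φ q.2 + q.1 * q.2)
      (Icc (0 : ℝ) 1 ×ˢ Icc (0 : ℝ) 1) := by
    have hφ2 : ContinuousOn (fun q : ℝ × ℝ => φ q.2) (Icc (0 : ℝ) 1 ×ˢ Icc (0 : ℝ) 1) :=
      hφ.comp continuous_snd.continuousOn fun q hq => hq.2
    exact ((continuous_const.sub continuous_fst).continuousOn.mul hφ2).add
      (continuous_fst.mul continuous_snd).continuousOn
  have hLI : MapsTo (fun q : ℝ × ℝ => (1 - q.1) * φ q.2 + q.1 * q.2)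
      (Icc (0 : ℝ) 1 ×ˢ Icc (0 : ℝ) 1) (Icc 0 1) := fun q hq => by
    have hs := hq.1; have hu := hφI hq.2; have hv := hq.2
    exact ⟨by nlinarith [hs.1, hs.2, hu.1, hv.1], by nlinarith [hs.1, hs.2, hu.2, hv.2]⟩
  refine span_single_sub_single_of_continuousHomotopy hZ ω h
    (fun q => γ.toFun ((1 - q.1) * φ q.2 + q.1 * q.2)) (γ.contDiffOn.continuousOn.comp hL hLI)
    (fun q hq => γ.mem_points _ (hLI hq)) (fun s _ => ?_) (fun s _ => ?_) γ' γ (fun t ht => ?_)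
    (fun t _ => ?_)
  · show γ.toFun ((1 - s) * φ 0 + s * 0) = γ.toFun ((1 - 0) * φ 0 + 0 * 0)
    rw [hφ0]; ring_nf
  · show γ.toFun ((1 - s) * φ 1 + s * 1) = γ.toFun ((1 - 0) * φ 1 + 0 * 1)
    rw [hφ1]; ring_nf
  · rw [hγ' t ht]; show γ.toFun (φ t) = γ.toFun ((1 - 0) * φ t + 0 * t); ring_nf
  · show γ.toFun t = γ.toFun ((1 - 1) * φ t + 1 * t); ring_nf

/-! ### Continuous triangles -/

/-- The broken path `t ↦ (φ(2t), 0)` (`t ≤ 1/2`), `(1 − φ(2t−1), φ(2t−1))` (`t ≥ 1/2`) along two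
edges of the standard triangle, `φ = smoothStep` (the parametrisation of `CurvePath.concat`).
[folklore] -/
def brokenEdgePath (t : ℝ) : ℝ × ℝ :=
  if t ≤ 1 / 2 then (smoothStep (2 * t), 0) else (1 - smoothStep (2 * t - 1), smoothStep (2 * t - 1))

/-- `brokenEdgePath` is continuous. [folklore] -/
theorem continuous_brokenEdgePath : Continuous brokenEdgePath := by
  have h1 : Continuous fun t : ℝ => ((smoothStep (2 * t), (0 : ℝ)) : ℝ × ℝ) :=
    (contDiff_smoothStep (n := 0)).continuous.comp (continuous_const.mul continuous_id) |>.prodMk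
      continuous_const
  have h2 : Continuous fun t : ℝ =>
      ((1 - smoothStep (2 * t - 1), smoothStep (2 * t - 1)) : ℝ × ℝ) := by
    have hs : Continuous fun t : ℝ => smoothStep (2 * t - 1) :=
      (contDiff_smoothStep (n := 0)).continuous.comp
        ((continuous_const.mul continuous_id).sub continuous_const)
    exact (continuous_const.sub hs).prodMk hs
  refine Continuous.if_le h1 h2 continuous_id continuous_const (fun t ht => ?_)
  rw [ht]
  norm_num

/-- `brokenEdgePath` maps `[0,1]` into the standard triangle. [folklore] -/
theorem brokenEdgePath_mem {t : ℝ} (ht : t ∈ Icc (0 : ℝ) 1) : brokenEdgePath t ∈ stdTriangle := by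
  unfold brokenEdgePath
  split_ifs with hle
  · have hu := mapsTo_smoothStep (two_mul_mem_Icc ⟨ht.1, hle⟩)
    exact ⟨hu.1, le_rfl, by linarith [hu.2]⟩
  · have hu := mapsTo_smoothStep (two_mul_sub_one_mem_Icc ⟨(not_le.mp hle).le, ht.2⟩)
    exact ⟨by linarith [hu.2], hu.1, by linarith⟩

/-- **(R5) for continuous triangles.** Let `τ : Δ → Z(ℂ)` be CONTINUOUS on the standard
triangle and let `e₀₁, e₁₂, e₀₂` be `C¹` paths on `Z` with algebraic end points agreeing on
`[0,1]` with the edges `τ(t, 0)`, `τ(1 − t, t)`, `τ(0, t)`. Then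
`(Z, ω, e₀₁) + (Z, ω, e₁₂) − (Z, ω, e₀₂)` lies in the span of the elementary relations: `τ`
composed with the convex combination of `t ↦ (0, t)` and the broken edge path is a continuous
homotopy with fixed end points from `e₀₂` to `e₀₁ ⋆ e₁₂`
(`span_single_sub_single_of_continuousHomotopy`, `span_concat`). This is the boundary relation
of relative singular homology in the book's sense (continuous `2`-simplices).
[cite: HuberWustholz2022, §3.3.1 (pp. 42–44)] -/
theorem span_boundary_of_continuousTriangle (hZ : Z.IsSmoothAffineCurve)
    (ω : Fin Z.n → MvPolynomial (Fin Z.n) ℂ) (h : ∀ i, HasAlgCoeffs (ω i))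
    (τ : ℝ × ℝ → (Fin Z.n → ℂ)) (hτ : ContinuousOn τ stdTriangle)
    (hτZ : MapsTo τ stdTriangle Z.points) (e₀₁ e₁₂ e₀₂ : CurvePath Z)
    (h₀₁ : ∀ t ∈ Icc (0 : ℝ) 1, e₀₁.toFun t = τ (t, 0))
    (h₁₂ : ∀ t ∈ Icc (0 : ℝ) 1, e₁₂.toFun t = τ (1 - t, t))
    (h₀₂ : ∀ t ∈ Icc (0 : ℝ) 1, e₀₂.toFun t = τ (0, t)) :
    InSpan (Finsupp.single (⟨Z, hZ, ω, h, e₀₁⟩ : PeriodSymbol) (1 : ℂ) +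
        Finsupp.single ⟨Z, hZ, ω, h, e₁₂⟩ 1 - Finsupp.single ⟨Z, hZ, ω, h, e₀₂⟩ 1) := by
  have hI0 : (0 : ℝ) ∈ Icc (0 : ℝ) 1 := ⟨le_rfl, zero_le_one⟩
  have hI1 : (1 : ℝ) ∈ Icc (0 : ℝ) 1 := ⟨zero_le_one, le_rfl⟩
  -- the `C¹` concatenation of the two edges
  have hj : e₀₁.toFun 1 = e₁₂.toFun 0 := by rw [h₀₁ 1 hI1, h₁₂ 0 hI0, sub_zero]
  have hcat := span_concat hZ ω h e₀₁ e₁₂ hj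
  -- the homotopy `τ((1 − s)(0, t) + s · brokenEdgePath t)`
  let L : ℝ × ℝ → ℝ × ℝ := fun q => (1 - q.1) • ((0 : ℝ), q.2) + q.1 • brokenEdgePath q.2
  have hLc : Continuous L :=
    ((continuous_const.sub continuous_fst).smul (continuous_const.prodMk continuous_snd)).add
      (continuous_fst.smul (continuous_brokenEdgePath.comp continuous_snd))
  have hLT : MapsTo L (Icc (0 : ℝ) 1 ×ˢ Icc (0 : ℝ) 1) stdTriangle := fun q hq => by
    have hx : ((0 : ℝ), q.2) ∈ stdTriangle :=
      ⟨le_rfl, hq.2.1, show (0 : ℝ) + q.2 ≤ 1 by linarith [hq.2.2]⟩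
    exact convex_stdTriangle hx (brokenEdgePath_mem hq.2) (by linarith [hq.1.2]) hq.1.1 (by ring)
  have hL0 : ∀ s, L (s, 0) = (0, 0) := fun s => by
    show (1 - s) • ((0 : ℝ), (0 : ℝ)) + s • brokenEdgePath 0 = (0, 0)
    rw [brokenEdgePath, if_pos (by norm_num), mul_zero, smoothStep_zero]
    simp
  have hL1 : ∀ s, L (s, 1) = (0, 1) := fun s => by
    show (1 - s) • ((0 : ℝ), (1 : ℝ)) + s • brokenEdgePath 1 = (0, 1)
    rw [brokenEdgePath, if_neg (by norm_num), show (2 : ℝ) * 1 - 1 = 1 by norm_num, smoothStep_one]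
    ext <;> simp
  have hL0t : ∀ t, L (0, t) = (0, t) := fun t => by
    show (1 - 0) • ((0 : ℝ), t) + (0 : ℝ) • brokenEdgePath t = (0, t)
    simp
  have hL1t : ∀ t, L (1, t) = brokenEdgePath t := fun t => by
    show (1 - 1) • ((0 : ℝ), t) + (1 : ℝ) • brokenEdgePath t = brokenEdgePath t
    simp
  have hhom := span_single_sub_single_of_continuousHomotopy hZ ω h (fun q => τ (L q))
    (hτ.comp hLc.continuousOn hLT) (fun q hq => hτZ (hLT hq))
    (fun s _ => by show τ (L (s, 0)) = τ (L (0, 0)); rw [hL0, hL0])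
    (fun s _ => by show τ (L (s, 1)) = τ (L (0, 1)); rw [hL1, hL1])
    e₀₂ (e₀₁.concat e₁₂ hj) (fun t ht => by show e₀₂.toFun t = τ (L (0, t)); rw [hL0t, h₀₂ t ht])
    (fun t ht => by
      show (e₀₁.concat e₁₂ hj).toFun t = τ (L (1, t))
      rw [hL1t, CurvePath.concat_apply, brokenEdgePath]
      split_ifs with hle
      · exact h₀₁ _ (mapsTo_smoothStep (two_mul_mem_Icc ⟨ht.1, hle⟩))
      · exact h₁₂ _ (mapsTo_smoothStep (two_mul_sub_one_mem_Icc ⟨(not_le.mp hle).le, ht.2⟩)))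
  obtain ⟨k, ρ, a, hρ, ha, he⟩ := span_add hhom hcat
  refine ⟨k, ρ, fun l => -a l, hρ, fun l => (ha l).neg, ?_⟩
  have he' : Finsupp.single (⟨Z, hZ, ω, h, e₀₁⟩ : PeriodSymbol) (1 : ℂ) +
      Finsupp.single ⟨Z, hZ, ω, h, e₁₂⟩ 1 - Finsupp.single ⟨Z, hZ, ω, h, e₀₂⟩ 1 =
      -(∑ l, a l • ρ l) := by rw [← he]; abel
  rw [he', ← Finset.sum_neg_distrib]
  exact Finset.sum_congr rfl fun l _ => (neg_smul (a l) (ρ l)).symm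

/-! ### Continuous squares -/

/-- The broken path along the left and the top edge of the unit square:
`t ↦ (0, φ(2t))` (`t ≤ 1/2`), `(φ(2t−1), 1)` (`t ≥ 1/2`), `φ = smoothStep`. [folklore] -/
def leftTopPath (t : ℝ) : ℝ × ℝ :=
  if t ≤ 1 / 2 then (0, smoothStep (2 * t)) else (smoothStep (2 * t - 1), 1)

/-- The broken path along the bottom and the right edge of the unit square:
`t ↦ (φ(2t), 0)` (`t ≤ 1/2`), `(1, φ(2t−1))` (`t ≥ 1/2`), `φ = smoothStep`. [folklore] -/
def bottomRightPath (t : ℝ) : ℝ × ℝ :=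
  if t ≤ 1 / 2 then (smoothStep (2 * t), 0) else (1, smoothStep (2 * t - 1))

/-- `t ↦ φ(2t)` is continuous. [folklore] -/
theorem continuous_smoothStep_two_mul : Continuous fun t : ℝ => smoothStep (2 * t) :=
  (contDiff_smoothStep (n := 0)).continuous.comp (continuous_const.mul continuous_id)

/-- `t ↦ φ(2t − 1)` is continuous. [folklore] -/
theorem continuous_smoothStep_two_mul_sub_one : Continuous fun t : ℝ => smoothStep (2 * t - 1) :=
  (contDiff_smoothStep (n := 0)).continuous.comp
    ((continuous_const.mul continuous_id).sub continuous_const)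

/-- `leftTopPath` is continuous. [folklore] -/
theorem continuous_leftTopPath : Continuous leftTopPath := by
  refine Continuous.if_le (continuous_const.prodMk continuous_smoothStep_two_mul)
    (continuous_smoothStep_two_mul_sub_one.prodMk continuous_const) continuous_id
    continuous_const (fun t ht => ?_)
  rw [ht]
  norm_num

/-- `bottomRightPath` is continuous. [folklore] -/
theorem continuous_bottomRightPath : Continuous bottomRightPath := by
  refine Continuous.if_le (continuous_smoothStep_two_mul.prodMk continuous_const)
    (continuous_const.prodMk continuous_smoothStep_two_mul_sub_one) continuous_id
    continuous_const (fun t ht => ?_)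
  rw [ht]
  norm_num

/-- `leftTopPath` maps `[0,1]` into the unit square. [folklore] -/
theorem leftTopPath_mem {t : ℝ} (ht : t ∈ Icc (0 : ℝ) 1) :
    leftTopPath t ∈ Icc (0 : ℝ) 1 ×ˢ Icc (0 : ℝ) 1 := by
  unfold leftTopPath
  split_ifs with hle
  · exact ⟨⟨le_rfl, zero_le_one⟩, mapsTo_smoothStep (two_mul_mem_Icc ⟨ht.1, hle⟩)⟩
  · exact ⟨mapsTo_smoothStep (two_mul_sub_one_mem_Icc ⟨(not_le.mp hle).le, ht.2⟩),
      ⟨zero_le_one, le_rfl⟩⟩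

/-- `bottomRightPath` maps `[0,1]` into the unit square. [folklore] -/
theorem bottomRightPath_mem {t : ℝ} (ht : t ∈ Icc (0 : ℝ) 1) :
    bottomRightPath t ∈ Icc (0 : ℝ) 1 ×ˢ Icc (0 : ℝ) 1 := by
  unfold bottomRightPath
  split_ifs with hle
  · exact ⟨mapsTo_smoothStep (two_mul_mem_Icc ⟨ht.1, hle⟩), ⟨le_rfl, zero_le_one⟩⟩
  · exact ⟨⟨zero_le_one, le_rfl⟩,
      mapsTo_smoothStep (two_mul_sub_one_mem_Icc ⟨(not_le.mp hle).le, ht.2⟩)⟩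

/-- **Continuous squares.** Let `H : [0,1]² → Z(ℂ)` be CONTINUOUS and let `b, r, τ, l` be `C¹`
paths on `Z` with algebraic end points agreeing on `[0,1]` with the bottom side `s ↦ H(s, 0)`,
the right side `t ↦ H(1, t)`, the top side `s ↦ H(s, 1)` and the left side `t ↦ H(0, t)`.
Then `(Z, ω, l) + (Z, ω, τ) − (Z, ω, b) − (Z, ω, r)` lies in the span of the elementary
relations: `H` composed with the convex combination of `leftTopPath` and `bottomRightPath` is a
continuous homotopy with fixed end points from `l ⋆ τ` to `b ⋆ r`
(`span_single_sub_single_of_continuousHomotopy`, `span_concat`). This is the boundary relation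
of a continuous singular square. [cite: HuberWustholz2022, §3.3.1 (pp. 42–44)] -/
theorem span_square_of_continuous (hZ : Z.IsSmoothAffineCurve)
    (ω : Fin Z.n → MvPolynomial (Fin Z.n) ℂ) (h : ∀ i, HasAlgCoeffs (ω i))
    (H : ℝ × ℝ → (Fin Z.n → ℂ)) (hH : ContinuousOn H (Icc (0 : ℝ) 1 ×ˢ Icc (0 : ℝ) 1))
    (hHZ : ∀ x ∈ Icc (0 : ℝ) 1 ×ˢ Icc (0 : ℝ) 1, H x ∈ Z.points) (b r τ l : CurvePath Z)
    (hb : ∀ s ∈ Icc (0 : ℝ) 1, b.toFun s = H (s, 0))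
    (hr : ∀ t ∈ Icc (0 : ℝ) 1, r.toFun t = H (1, t))
    (hτ : ∀ s ∈ Icc (0 : ℝ) 1, τ.toFun s = H (s, 1))
    (hl : ∀ t ∈ Icc (0 : ℝ) 1, l.toFun t = H (0, t)) :
    InSpan (Finsupp.single (⟨Z, hZ, ω, h, l⟩ : PeriodSymbol) (1 : ℂ) +
        Finsupp.single ⟨Z, hZ, ω, h, τ⟩ 1 - Finsupp.single ⟨Z, hZ, ω, h, b⟩ 1 -
        Finsupp.single ⟨Z, hZ, ω, h, r⟩ 1) := by
  have hI0 : (0 : ℝ) ∈ Icc (0 : ℝ) 1 := ⟨le_rfl, zero_le_one⟩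
  have hI1 : (1 : ℝ) ∈ Icc (0 : ℝ) 1 := ⟨zero_le_one, le_rfl⟩
  have hjl : l.toFun 1 = τ.toFun 0 := by rw [hl 1 hI1, hτ 0 hI0]
  have hjb : b.toFun 1 = r.toFun 0 := by rw [hb 1 hI1, hr 0 hI0]
  have hcl := span_concat hZ ω h l τ hjl
  have hcb := span_concat hZ ω h b r hjb
  -- the homotopy `H((1 − s) · leftTopPath t + s · bottomRightPath t)`
  let L : ℝ × ℝ → ℝ × ℝ := fun q => (1 - q.1) • leftTopPath q.2 + q.1 • bottomRightPath q.2
  have hLc : Continuous L :=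
    ((continuous_const.sub continuous_fst).smul (continuous_leftTopPath.comp continuous_snd)).add
      (continuous_fst.smul (continuous_bottomRightPath.comp continuous_snd))
  have hconv : Convex ℝ (Icc (0 : ℝ) 1 ×ˢ Icc (0 : ℝ) 1) := (convex_Icc 0 1).prod (convex_Icc 0 1)
  have hLT : MapsTo L (Icc (0 : ℝ) 1 ×ˢ Icc (0 : ℝ) 1) (Icc (0 : ℝ) 1 ×ˢ Icc (0 : ℝ) 1) :=
    fun q hq => hconv (leftTopPath_mem hq.2) (bottomRightPath_mem hq.2) (by linarith [hq.1.2])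
      hq.1.1 (by ring)
  have hL0 : ∀ s, L (s, 0) = (0, 0) := fun s => by
    show (1 - s) • leftTopPath 0 + s • bottomRightPath 0 = (0, 0)
    rw [leftTopPath, bottomRightPath, if_pos (by norm_num), if_pos (by norm_num), mul_zero,
      smoothStep_zero]
    simp
  have hL1 : ∀ s, L (s, 1) = (1, 1) := fun s => by
    show (1 - s) • leftTopPath 1 + s • bottomRightPath 1 = (1, 1)
    rw [leftTopPath, bottomRightPath, if_neg (by norm_num), if_neg (by norm_num),
      show (2 : ℝ) * 1 - 1 = 1 by norm_num, smoothStep_one]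
    ext <;> simp
  have hL0t : ∀ t, L (0, t) = leftTopPath t := fun t => by
    show (1 - 0) • leftTopPath t + (0 : ℝ) • bottomRightPath t = leftTopPath t
    simp
  have hL1t : ∀ t, L (1, t) = bottomRightPath t := fun t => by
    show (1 - 1) • leftTopPath t + (1 : ℝ) • bottomRightPath t = bottomRightPath t
    simp
  have hhom := span_single_sub_single_of_continuousHomotopy hZ ω h (fun q => H (L q))
    (hH.comp hLc.continuousOn hLT) (fun q hq => hHZ _ (hLT hq))
    (fun s _ => by show H (L (s, 0)) = H (L (0, 0)); rw [hL0, hL0])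
    (fun s _ => by show H (L (s, 1)) = H (L (0, 1)); rw [hL1, hL1])
    (l.concat τ hjl) (b.concat r hjb)
    (fun t ht => by
      show (l.concat τ hjl).toFun t = H (L (0, t))
      rw [hL0t, CurvePath.concat_apply, leftTopPath]
      split_ifs with hle
      · exact hl _ (mapsTo_smoothStep (two_mul_mem_Icc ⟨ht.1, hle⟩))
      · exact hτ _ (mapsTo_smoothStep (two_mul_sub_one_mem_Icc ⟨(not_le.mp hle).le, ht.2⟩)))
    (fun t ht => by
      show (b.concat r hjb).toFun t = H (L (1, t))
      rw [hL1t, CurvePath.concat_apply, bottomRightPath]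
      split_ifs with hle
      · exact hb _ (mapsTo_smoothStep (two_mul_mem_Icc ⟨ht.1, hle⟩))
      · exact hr _ (mapsTo_smoothStep (two_mul_sub_one_mem_Icc ⟨(not_le.mp hle).le, ht.2⟩)))
  obtain ⟨k, ρ, a, hρ, ha, he⟩ := span_sub (span_add hhom hcb) hcl
  exact ⟨k, ρ, a, hρ, ha, by rw [← he]; abel⟩

/-- **Free homotopies of loops with a `C¹` base-point track.** Let `H : [0,1]² → Z(ℂ)` be
continuous with `H(s, 0) = H(s, 1) = δ(s)` for a `C¹` path `δ` with algebraic end points, and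
let the loops `γ₀ = H(0, ·)`, `γ₁ = H(1, ·)` be `C¹`. Then `(Z, ω, γ₀) − (Z, ω, γ₁)` lies in
the span of the elementary relations (`span_square_of_continuous` with bottom = top = `δ`).
[cite: HuberWustholz2022, §3.3.1 (pp. 42–44): "a closed path"] -/
theorem span_single_sub_single_of_continuousFreeHomotopy (hZ : Z.IsSmoothAffineCurve)
    (ω : Fin Z.n → MvPolynomial (Fin Z.n) ℂ) (h : ∀ i, HasAlgCoeffs (ω i))
    (H : ℝ × ℝ → (Fin Z.n → ℂ)) (hH : ContinuousOn H (Icc (0 : ℝ) 1 ×ˢ Icc (0 : ℝ) 1))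
    (hHZ : ∀ x ∈ Icc (0 : ℝ) 1 ×ˢ Icc (0 : ℝ) 1, H x ∈ Z.points) (δ : CurvePath Z)
    (hδ0 : ∀ s ∈ Icc (0 : ℝ) 1, δ.toFun s = H (s, 0))
    (hδ1 : ∀ s ∈ Icc (0 : ℝ) 1, δ.toFun s = H (s, 1)) (γ₀ γ₁ : CurvePath Z)
    (hγ₀ : ∀ t ∈ Icc (0 : ℝ) 1, γ₀.toFun t = H (0, t))
    (hγ₁ : ∀ t ∈ Icc (0 : ℝ) 1, γ₁.toFun t = H (1, t)) :
    InSpan (Finsupp.single (⟨Z, hZ, ω, h, γ₀⟩ : PeriodSymbol) (1 : ℂ) -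
        Finsupp.single ⟨Z, hZ, ω, h, γ₁⟩ 1) := by
  have hsq := span_square_of_continuous hZ ω h H hH hHZ δ γ₁ δ γ₀ hδ0 hγ₁ hδ1 hγ₀
  rwa [add_sub_cancel_right] at hsq

end CurvePeriods

end Literature.NumberTheory.Transcendental

end
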